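import Summits.BirchSwinnertonDyer.Rank1Residual.WAll.TargetCMTwoInertKrizLiTwoFortyThree
import Summits.BirchSwinnertonDyer.Rank1Residual.P2.ShuZhaiOneFortyFourCurve
import Summits.BirchSwinnertonDyer.Rank1Residual.P2.CornerFTwoModelLocalTwo
import Summits.BirchSwinnertonDyer.Rank1Residual.P2.TransportAtTwo
import Summits.BirchSwinnertonDyer.Rank1Residual.X12.CMIsogenyInvariance
import Summits.BirchSwinnertonDyer.Rank1Residual.Partition.CornersCMDecide
import HarnessLib
import HarnessLib.Audit.Tags

/-!
# Rung W-ALL of ladder BSD (D-0120) — the INERT slices of row 12₂ cut a THIRD time, flag-free: ON / OFF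
# the `ℚ`-isogeny classes of the explicit Shu–Zhai twists of the SECOND `j = 0` base `144a1 : y² = x³ − 1`
# (`144a1^{(−pM)} ≅ y² = x³ + (pM)³`; cell `bsd-print-cf2`, D-0131 (2) PRINT TIER, seat p4; route `PrintCf2`
# aside `InertShuZhaiOneFortyFourOfFactsPlus` = stmt-BirchSwinnertonDyer-21260, crux `InertJZeroOfFacts` =
# stmt-BirchSwinnertonDyer-20671)

HONEST FRAMING (cell `bsd-print-cf2`, run/shared/lean/pub/bsd-print-cf2/; the partition leaf «CornerF @ `2`» =
`Summit.BirchSwinnertonDyer.WAllCornerFTwo` is OPEN AS A CLASS): STATEMENTS AND BOOKKEEPING ONLY in §3–§4 —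
nothing asserted, nothing booked, no named fact introduced, no published theorem restated; the two
`@[conjecture] def`s are OPEN obligations and SLICES of the registered leaf (via `WAll/TargetCMTwoSlices.lean`,
p532371, and p3's cuts `WAll/TargetCMTwoInertShuZhaiThirtySix.lean`, `WAll/TargetCMTwoInertKrizLiTwoFortyThree.lean`).
§1–§2 are unconditional kernel theorems about ONE explicit family (membership predicates with a body;
placement: CM, `2` inert in `K = ℚ(√−3)`, BAD reduction at `2`).

THE FAMILY (lit g4, DOSSIER §17; print = Shu–Zhai, J. reine angew. Math. 775 (2021) Thm 1.2 / Thm 1.4 /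
Thm 4.10 at the optimal CM base `E₀ = 144a1 = [0,0,0,0,−1] = 36a1^{(−1)}`, conductor `144 = 2⁴3²`, Cremona
Table 1: optimal, `E₀(ℚ) ≅ ℤ/2`; Table 4: `L(E₀,1)/Ω = 1/2`, so `f([0]) = (0,0) ∉ 2E₀(ℚ)` — tree fact
`ShuZhai2021.base144a1_optimal_cuspZero`, p551268; model `ShuZhai2021.curve144a1 = [0,3,0,3,0]`): for every
prime `p ≡ 23 (mod 24)` and every finite set `Q` of primes `q ≡ 5 (mod 12)` with `M = ∏ q ≡ 1 (mod 24)`, the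
twist `E₀^{(−pM)} ≅ y² = x³ + (pM)³` has `ord_{s=1} L = rank = 1`, `Ш` finite of odd order,
`ord₂(L′/ΩR) = #Q`, and satisfies BSD(·,2) (transported from `BSD(E₀,2)` = CM rank zero, row C8) — the
SIGN-TWIN of p3's `36a1` family `y² = x³ − (pM)³` (aside 20597, CLOSED). By Shu–Zhai's own hypotheses the
door yields exactly the non-split bases `36a1`, `144a1`, `256c1` among all CM curves (DOSSIER §17.4).

This file NAMES the family and carves it out of the current named residual of the inert `j = 0` road
(`WAllCornerFTwoInertOffShuZhaiOffKrizLi`, p3 g2): §1 membership predicates `P2.IsShuZhaiOneFortyFourTwist`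
(ℚ-models of `144a1^{(−pM)}`) and `P2.IsIsogenousToShuZhaiOneFortyFourTwist` (their `ℚ`-isogeny classes —
EXACTLY the membership clause of aside 21260: p3's `IsIsogenousToShuZhaiThirtySixTwist` with `curve36a1 ↦
ShuZhai2021.curve144a1`, nothing else changed); §2 placement (unconditional): CM, `2` INERT, BAD at `2`
(`y² = x³ + B`, `B = (pM)³` odd: a globally minimal model of the sextic is good at `2` iff `B ≡ 16 (mod 64)`,
ty2's atlas lemma `CornerFTwo.Atlas.good_two_iff_of_smul_sextic`; good reduction is an isogeny invariant) — so
the family lies in the slice `WAllCornerFTwoInertBad` alone and in crux 20671 (`j = 0` on the twist);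
§3 the leaf `WAllCornerFTwoInertShuZhaiOneFortyFour` (= the consequent of aside 21260 with the predicate
folded) and the new residual `WAllCornerFTwoInertOffShuZhaiOffKrizLiOffShuZhaiOneFortyFour` (OPEN; no
print); §4 glue (excluded middle on membership; every cut EXACT). The CLOSER of the leaf granted the named
facts BY NAME (Shu–Zhai Thm 1.2 / 1.4, Cassels, row C8, modularity, ARS06 Thm 2.6,
`base144a1_optimal_cuspZero`) is seat p4's `Theorems/PrintCf2InertShuZhaiOneFortyFour*.lean` on ty2 g2's
setting file `P2/ShuZhaiOneFortyFourCurve.lean` and p2 g3's `P2/ShuZhaiCMBaseTransport.lean`.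

| slice `Prop` (this file) | shape (all `∀ W [..] [..], W.HasCM → W.analyticRank = 1 → CMInert W 2 → …`) | status |
|---|---|---|
| `WAllCornerFTwoInertShuZhaiOneFortyFour` | `… → P2.IsIsogenousToShuZhaiOneFortyFourTwist W → BSDp W 2` | closed granted facts (Theorems file) |
| `WAllCornerFTwoInertOffShuZhaiOffKrizLiOffShuZhaiOneFortyFour` | `… → ¬ SZ36 → ¬ KL243 → ¬ SZ144 → BSDp W 2` | OPEN (the residual) |

Seat p4's strategy sentence («2-adic CM Iwasawa road …») is booked as beyond-print NO with its named residual
(MEMO-p4-IWASAWA2.md; crux 20368 + the non-split classes); this file is the idle by-name consumer task of the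
cell (STATUS 2026-08-27T17:59:44Z TAKES). beyond-print theorem: NO (Shu–Zhai's printed theorems read on the
leaf; the CM base certificate is Rubin / Burungale–Flach). PARTITION: the sub-cell «`y² = x³ + (pM)³`» of crux
20671 (inert, bad at `2`) moves from NO PRINT to IN PRINT by name once the Theorems closer lands.

References: `WAll/TargetCMTwoSlices.lean` (p532371), `WAll/TargetCMTwoInertShuZhaiThirtySix.lean` (p3),
`WAll/TargetCMTwoInertKrizLiTwoFortyThree.lean` (p3 g2, p547569), `WAll/TargetCMTwoRamifiedShuZhaiTwoFiftySix.lean`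
(p2 g3, p551803 — the pattern of §1–§4), `P2/CornerFTwoModelLocalTwo.lean` (ty2 g2, p548585),
`X12/CMIsogenyInvariance.lean`, `Literature/…/ShuZhai2021/Base144a1.lean` (lit g4, p551268), route file
`Summits/BirchSwinnertonDyer/BirchSwinnertonDyer/Theses/PrintCf2.lean` (items 20671, 21260); cell dossier
run/shared/lean/pub/bsd-print-cf2/DOSSIER.md §17. [cite: ShuZhai2021, Thm. 1.2, Thm. 1.4, Thm. 4.10
(arXiv:2102.11808 chunks p0003 L24–L45, p0013 L14–L26)] [cite: Cremona1997, Table 1 (N = 144, curve A1) and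
Table 4 (row 144 A)] [cite: MilneADT2006, Thm. I.7.3] [cite: Miller2011LMS, §1 and Def. 1.1] (the currency
`BSD(E,p)`).
-/

noncomputable section

open scoped Classical

open WeierstrassCurve Literature.NumberTheory.EllipticCurves
  Literature.NumberTheory.EllipticCurves.Rank1Residual Literature.NumberTheory.EllipticCurves.ModularForms
  Literature.NumberTheory.EllipticCurves.ShuZhai2021
open Summit.BirchSwinnertonDyer.Rank1Residual

set_option autoImplicit false

/-! ### §1. Membership predicates (definitions with a body: data `p`, `Q`, `C`) -/

namespace Summit.BirchSwinnertonDyer.Rank1Residual.P2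

/-- **`W` is a `ℚ`-model of an explicit Shu–Zhai twist of `144a1`**: a prime `p ≡ 23 (mod 24)`, a finite set
`Q` of primes `≡ 5 (mod 12)` with `∏ q ≡ 1 (mod 24)`, and a `ℚ`-isomorphism `C • 144a1^{(−p∏q)} = W`
(`144a1^{(D)}` = `curve144a1.quadraticTwist D : y² = x³ + 3D x² + 3D² x ≅ Y² = X³ − D³`, so the member is
`Y² = X³ + (p∏q)³`). A definition with a body (data), not a named fact; p3's `IsShuZhaiThirtySixTwist` with
`curve36a1 ↦ ShuZhai2021.curve144a1`. [cite: ShuZhai2021, Thm. 1.2, Def. 1.1 and Thm. 1.4 (ii)]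
[cite: Cremona1997, Table 1 (N = 144, curve A1) and Table 4 (row 144 A)] -/
def IsShuZhaiOneFortyFourTwist (W : WeierstrassCurve ℚ) : Prop :=
  ∃ (p : ℕ) (Q : Finset ℕ) (C : VariableChange ℚ), p.Prime ∧ p % 24 = 23 ∧
    (∀ q ∈ Q, q.Prime ∧ q % 12 = 5) ∧ (∏ q ∈ Q, q) % 24 = 1 ∧
    C • curve144a1.quadraticTwist (-((p * ∏ q ∈ Q, q : ℕ) : ℚ)) = W

/-- **`W` is `ℚ`-ISOGENOUS to an explicit Shu–Zhai twist of `144a1`** — EXACTLY the membership clause of route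
`PrintCf2` aside `InertShuZhaiOneFortyFourOfFactsPlus` (stmt-BirchSwinnertonDyer-21260): p3's
`IsIsogenousToShuZhaiThirtySixTwist` with `curve36a1 ↦ ShuZhai2021.curve144a1`, nothing else changed (the class
contains the models of the twists of all four curves `144a1–144a4`; Cassels' invariance is conjunct 3 of
`𝔅_inert`). A definition with a body (data `p`, `Q`). [cite: ShuZhai2021, Thm. 1.2, Def. 1.1 and Thm. 1.4 (ii)]
[cite: Cremona1997, Table 1 (N = 144, class A)] -/
def IsIsogenousToShuZhaiOneFortyFourTwist (W : WeierstrassCurve ℚ) : Prop :=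
  ∃ (p : ℕ) (Q : Finset ℕ), p.Prime ∧ p % 24 = 23 ∧ (∀ q ∈ Q, q.Prime ∧ q % 12 = 5) ∧
    (∏ q ∈ Q, q) % 24 = 1 ∧ IsIsogenous W (curve144a1.quadraticTwist (-((p * ∏ q ∈ Q, q : ℕ) : ℚ)))

/-- The isogeny-class predicate IS the membership clause of aside 21260, on the nose. [folklore] -/
theorem isIsogenousToShuZhaiOneFortyFourTwist_iff (W : WeierstrassCurve ℚ) :
    IsIsogenousToShuZhaiOneFortyFourTwist W ↔
      ∃ (p : ℕ) (Q : Finset ℕ), p.Prime ∧ p % 24 = 23 ∧ (∀ q ∈ Q, q.Prime ∧ q % 12 = 5) ∧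
        (∏ q ∈ Q, q) % 24 = 1 ∧ IsIsogenous W (curve144a1.quadraticTwist (-((p * ∏ q ∈ Q, q : ℕ) : ℚ))) :=
  Iff.rfl

/-- The twisting parameter `p∏q` of a member is a nonzero natural number (all factors prime). [folklore] -/
theorem mul_prod_ne_zero_of_prime_of_forall_prime {p : ℕ} (hp : p.Prime) {Q : Finset ℕ}
    (hQ : ∀ q ∈ Q, q.Prime ∧ q % 12 = 5) : p * ∏ q ∈ Q, q ≠ 0 :=
  Nat.pos_iff_ne_zero.mp (Nat.mul_pos hp.pos (Finset.prod_pos fun q hq => (hQ q hq).1.pos))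

/-- … hence nonzero as the rational twisting parameter `−p∏q`. [folklore] -/
theorem neg_cast_mul_prod_ne_zero {p : ℕ} (hp : p.Prime) {Q : Finset ℕ} (hQ : ∀ q ∈ Q, q.Prime ∧ q % 12 = 5) :
    (-((p * ∏ q ∈ Q, q : ℕ) : ℚ)) ≠ 0 :=
  neg_ne_zero.mpr (by exact_mod_cast mul_prod_ne_zero_of_prime_of_forall_prime hp hQ)

/-- The `r = 0` members: every `ℚ`-model of `144a1^{(−p)}` (`≅ y² = x³ + p³`), `p ≡ 23 (mod 24)` prime, is in
the family (`Q = ∅`). [cite: ShuZhai2021, Thm. 1.2 (r = 0)] -/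
theorem isShuZhaiOneFortyFourTwist_of_prime {p : ℕ} (hp : p.Prime) (h24 : p % 24 = 23)
    {W : WeierstrassCurve ℚ} {C : VariableChange ℚ} (hC : C • curve144a1.quadraticTwist (-(p : ℚ)) = W) :
    IsShuZhaiOneFortyFourTwist W :=
  ⟨p, ∅, C, hp, h24, fun q hq => absurd hq (Finset.notMem_empty q), by simp, by simpa using hC⟩

/-- Models are isogenous (an isomorphism is an isogeny): `IsShuZhaiOneFortyFourTwist W →
IsIsogenousToShuZhaiOneFortyFourTwist W`. [cite: SilvermanAEC2009, III.4] -/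
theorem isIsogenousToShuZhaiOneFortyFourTwist_of_isShuZhaiOneFortyFourTwist {W : WeierstrassCurve ℚ}
    (hW : IsShuZhaiOneFortyFourTwist W) : IsIsogenousToShuZhaiOneFortyFourTwist W := by
  obtain ⟨p, Q, C, hp, h24, hQ, hM, hC⟩ := hW
  exact ⟨p, Q, hp, h24, hQ, hM, isIsogenous_of_smul_eq' hC⟩

/-! ### §2. Placement (unconditional): CM, `2` INERT in `K = ℚ(√−3)`, BAD reduction at `2` -/

/-- **Every elliptic `W` `ℚ`-isogenous to a twist of `144a1` has CM and `2` INERT in its CM field**: the twist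
itself has CM with `2` inert (`j = 0`, `d_K = −3`; ty2's `hasCM_and_cmInert_two_of_smul_twist_curve144a1` at
`C = 1`), and CM / the CM field are isogeny invariants (`X12.hasCM_of_isIsogenous`, `X12.cmInert_iff_of_isIsogenous`).
[cite: SilvermanAEC2009, Cor. III.9.4] [cite: Cox2013, §5.B Prop. 5.16] -/
theorem hasCM_and_cmInert_two_of_isIsogenous_twist_curve144a1 {d : ℚ} (hd : d ≠ 0)
    (W : WeierstrassCurve ℚ) [W.IsElliptic] (hiso : IsIsogenous W (curve144a1.quadraticTwist d)) :
    W.HasCM ∧ CMInert W 2 := by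
  haveI := curve144a1.isElliptic_quadraticTwist hd
  obtain ⟨hT, hTin⟩ := hasCM_and_cmInert_two_of_smul_twist_curve144a1 hd
    (show (1 : VariableChange ℚ) • curve144a1.quadraticTwist d = curve144a1.quadraticTwist d from one_smul _ _)
  have hcmW : W.HasCM := X12.hasCM_of_isIsogenous hiso.symm_of_charZero hT
  exact ⟨hcmW, (X12.cmInert_iff_of_isIsogenous hiso hcmW 2).2 hTin⟩

/-- **BAD reduction at `2` along the isogeny class of a member** `144a1^{(−p∏q)} ≅ y² = x³ + B`, `B = (p∏q)³`
ODD (`p ≡ 23 (mod 24)`, `q ≡ 5 (mod 12)`): a globally minimal model of the sextic `y² = x³ + B` (`64 ∤ B`) is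
good at `2` iff `B ≡ 16 (mod 64)` (ty2's atlas lemma `CornerFTwo.Atlas.good_two_iff_of_smul_sextic`, the twist written as the sextic by ty2's
`smul_quadraticTwist_curve144a1`), impossible for odd `B`; and good reduction at `2` is a `ℚ`-isogeny invariant
(`IsIsogenous.hasGoodReductionAtPrime_iff`, AEC VII.7.2). [cite: SilvermanAEC2009, VII.5 Prop. 5.1 and Cor. VII.7.2] -/
theorem not_good_two_of_isIsogenous_twist_curve144a1 {p : ℕ} (hp : p.Prime) (h24 : p % 24 = 23)
    {Q : Finset ℕ} (hQ : ∀ q ∈ Q, q.Prime ∧ q % 12 = 5) (W : WeierstrassCurve ℚ) [W.IsElliptic]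
    (hiso : IsIsogenous W (curve144a1.quadraticTwist (-((p * ∏ q ∈ Q, q : ℕ) : ℚ)))) : ¬ Good W 2 := by
  set m : ℕ := p * ∏ q ∈ Q, q with hm
  -- `m = p∏q` is odd, so `B = m³` is odd: `B ≠ 0`, `64 ∤ B`, `B % 64 ≠ 16`
  have hprod : Odd (∏ q ∈ Q, q) :=
    Finset.prod_induction _ (fun n => Odd n) (fun a b ha hb => ha.mul hb) odd_one
      (fun q hq => (hQ q hq).1.odd_of_ne_two (by have := (hQ q hq).2; omega))
  have hmodd : Odd (m : ℤ) := by exact_mod_cast (hp.odd_of_ne_two (by omega)).mul hprod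
  have hm0 : (m : ℤ) ≠ 0 := fun h0 => by rw [h0] at hmodd; exact (by decide : ¬ Odd (0 : ℤ)) hmodd
  have hB : (m : ℤ) ^ 3 ≠ 0 := pow_ne_zero 3 hm0
  have hB2 : (m : ℤ) ^ 3 % 2 = 1 := Int.odd_iff.mp hmodd.pow
  have h64 : ¬ (64 : ℤ) ∣ (m : ℤ) ^ 3 := by omega
  have h16 : ¬ ((m : ℤ) ^ 3 % 64 = 16) := by omega
  have hd0 : (-(m : ℚ)) ≠ 0 := neg_ne_zero.mpr (by exact_mod_cast hm0)
  haveI := curve144a1.isElliptic_quadraticTwist hd0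
  -- a globally minimal model `WpM` of the twist, written as a model of the sextic `y² = x³ + m³`
  obtain ⟨WpM, _, _, C, hC⟩ := exists_globallyMinimal_twist curve144a1 hd0
  have hV := smul_quadraticTwist_curve144a1 (-(m : ℚ))
  have hS : -(-(m : ℚ)) ^ 3 = (((m : ℤ) ^ 3 : ℤ) : ℚ) := by push_cast; ring
  rw [hS] at hV
  have hT : curve144a1.quadraticTwist (-(m : ℚ)) =
      (⟨1, -(-(m : ℚ)), 0, 0⟩ : VariableChange ℚ)⁻¹ •
        (⟨0, 0, 0, 0, (((m : ℤ) ^ 3 : ℤ) : ℚ)⟩ : WeierstrassCurve ℚ) :=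
    (inv_smul_eq_iff.mpr hV.symm).symm
  have hC' : (C * (⟨1, -(-(m : ℚ)), 0, 0⟩ : VariableChange ℚ)⁻¹) •
      (⟨0, 0, 0, 0, (((m : ℤ) ^ 3 : ℤ) : ℚ)⟩ : WeierstrassCurve ℚ) = WpM := by
    rw [mul_smul, ← hT, hC]
  have hbad : ¬ Good WpM 2 := fun hg =>
    h16 ((CornerFTwo.Atlas.good_two_iff_of_smul_sextic hB h64 hC').mp hg)
  -- `W ∼ 144a1^{(−m)} ≅ WpM`, and good reduction at `2` is an isogeny invariant
  have hiso' : IsIsogenous W WpM := hiso.trans' (by rw [← hC]; exact isIsogenous_smul _ C)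
  exact fun hg => hbad ((hiso'.hasGoodReductionAtPrime_iff 2).mp hg)

/-- **Placement of the isogeny classes** (unconditional): every elliptic `W` `ℚ`-isogenous to an explicit
Shu–Zhai twist of `144a1` has CM, `2` INERT in its CM field `ℚ(√−3)`, and BAD reduction at `2` — the family
lies in p4's slice `WAllCornerFTwoInertBad` (`WAll/TargetCMTwoSlices.lean`) alone, inside crux 20671
`InertJZeroOfFacts` (`j = 0` on the twist; its registered cut `stub_inertJZero_badAtTwo`).
[cite: SilvermanAEC2009, Cor. III.9.4, VII.5 Prop. 5.1 and Cor. VII.7.2] -/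
theorem placement_of_isIsogenousToShuZhaiOneFortyFourTwist (W : WeierstrassCurve ℚ) [W.IsElliptic]
    (hW : IsIsogenousToShuZhaiOneFortyFourTwist W) : W.HasCM ∧ CMInert W 2 ∧ ¬ Good W 2 := by
  obtain ⟨p, Q, hp, h24, hQ, -, hiso⟩ := hW
  obtain ⟨hcm, hin⟩ :=
    hasCM_and_cmInert_two_of_isIsogenous_twist_curve144a1 (neg_cast_mul_prod_ne_zero hp hQ) W hiso
  exact ⟨hcm, hin, not_good_two_of_isIsogenous_twist_curve144a1 hp h24 hQ W hiso⟩

/-- **Placement of the models** (unconditional): CM, `2` inert, bad at `2`.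
[cite: SilvermanAEC2009, Cor. III.9.4 and VII.5 Prop. 5.1] -/
theorem placement_of_isShuZhaiOneFortyFourTwist (W : WeierstrassCurve ℚ) [W.IsElliptic]
    (hW : IsShuZhaiOneFortyFourTwist W) : W.HasCM ∧ CMInert W 2 ∧ ¬ Good W 2 :=
  placement_of_isIsogenousToShuZhaiOneFortyFourTwist W
    (isIsogenousToShuZhaiOneFortyFourTwist_of_isShuZhaiOneFortyFourTwist hW)

/-- A member of analytic rank one is a point of the leaf (`CornerF W 2`) and of the SHARP corner `CornerF♯ W 2`
(`2` inert in `K`: never good ordinary at `2`; tree `cornerFSharp_two_iff_dvd_or_cmInert`) — so a BSD₂ theorem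
on the family is PARTITION currency for rung W-ALL/12.K12-2, slice INERT-BAD. [folklore] -/
theorem cornerF_and_cornerFSharp_of_isIsogenousToShuZhaiOneFortyFourTwist (W : WeierstrassCurve ℚ)
    [W.IsElliptic] [W.IsGloballyMinimal] (hW : IsIsogenousToShuZhaiOneFortyFourTwist W)
    (hr1 : W.analyticRank = 1) : CornerF W 2 ∧ CornerFSharp W 2 := by
  obtain ⟨hcm, hin, -⟩ := placement_of_isIsogenousToShuZhaiOneFortyFourTwist W hW
  exact ⟨⟨hcm, hr1, Or.inl rfl⟩, cornerFSharp_two_iff_dvd_or_cmInert.2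
    ⟨hasCM_iff_j_mem_cmJInvariants.1 hcm, hr1, Or.inr hin⟩⟩

end Summit.BirchSwinnertonDyer.Rank1Residual.P2

namespace Summit.BirchSwinnertonDyer

/-! ### §3. The inert slices cut along the Shu–Zhai `144a1` isogeny classes -/

/-- **Inert slices ON THE SHU–ZHAI `144a1` ISOGENY CLASSES** (closed granted named facts by seat p4's
Theorems file `PrintCf2InertShuZhaiOneFortyFour*`): CM, `ord_{s=1} L(E,s) = 1`, `2` inert in `K`, `W`
`ℚ`-isogenous to an explicit twist `144a1^{(−p∏q)} ≅ y² = x³ + (p∏q)³` ⇒ `BSD(E,2)`. With the predicate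
unfolded this is LITERALLY the consequent of route `PrintCf2` aside 21260 `InertShuZhaiOneFortyFourOfFactsPlus`
(`wAllCornerFTwoInertShuZhaiOneFortyFour_iff_item`). [folklore] -/
@[conjecture] def WAllCornerFTwoInertShuZhaiOneFortyFour : Prop :=
  ∀ (W : WeierstrassCurve ℚ) [W.IsElliptic] [W.IsGloballyMinimal],
    W.HasCM → W.analyticRank = 1 → CMInert W 2 → P2.IsIsogenousToShuZhaiOneFortyFourTwist W → BSDp W 2

/-- **Inert slices OFF ALL THREE EXPLICIT FAMILIES (OPEN) — the residual of the inert `j = 0` / odd-Heegner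
roads (v3).** CM, `ord_{s=1} L(E,s) = 1`, `2` inert in `K`, `W` NOT `ℚ`-isogenous to any explicit Shu–Zhai twist
of `36a1`, NOT to any Kriz–Li twist of `243a1`, NOT to any explicit Shu–Zhai twist of `144a1` ⇒ `BSD(E,2)`.
Contains every cube-sum curve off the class of `x³ + y³ = 9` (𝒞_HSY = K7t `X12.CMAtTwo` included), the other
Mordell curves `y² = x³ + k`, the `27a4` / `j = 54000` twists, and the five odd Heegner fields (crux 20672);
nothing in print (DOSSIER §15–§17). [folklore] -/
@[conjecture] def WAllCornerFTwoInertOffShuZhaiOffKrizLiOffShuZhaiOneFortyFour : Prop :=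
  ∀ (W : WeierstrassCurve ℚ) [W.IsElliptic] [W.IsGloballyMinimal],
    W.HasCM → W.analyticRank = 1 → CMInert W 2 → ¬ P2.IsIsogenousToShuZhaiThirtySixTwist W →
      ¬ P2.IsIsogenousToKrizLiTwoFortyThreeTwist W → ¬ P2.IsIsogenousToShuZhaiOneFortyFourTwist W → BSDp W 2

/-- **The ON-leaf with the predicate unfolded IS the consequent of aside 21260** (so a proof of either is a
proof of the other; `Iff.rfl`). [folklore] -/
theorem wAllCornerFTwoInertShuZhaiOneFortyFour_iff_item :
    WAllCornerFTwoInertShuZhaiOneFortyFour ↔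
      ∀ (W : WeierstrassCurve ℚ) [W.IsElliptic] [W.IsGloballyMinimal], W.HasCM → W.analyticRank = 1 →
        CMInert W 2 → (∃ (p : ℕ) (Q : Finset ℕ), p.Prime ∧ p % 24 = 23 ∧ (∀ q ∈ Q, q.Prime ∧ q % 12 = 5) ∧
          (∏ q ∈ Q, q) % 24 = 1 ∧
          IsIsogenous W (curve144a1.quadraticTwist (-((p * ∏ q ∈ Q, q : ℕ) : ℚ)))) → BSDp W 2 :=
  Iff.rfl

/-! ### §4. Glue (excluded middle on the three memberships; good/bad at `2`) — every cut EXACT -/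

/-- **The two inert slices ⟺ ON SZ36 ∧ ON KL243 ∧ ON SZ144 ∧ OFF all three** (EXACT; pure logic). [folklore] -/
theorem wAllCornerFTwoInert_iff_shuZhai_krizLi_shuZhai144_off :
    (WAllCornerFTwoInertGood ∧ WAllCornerFTwoInertBad) ↔
      WAllCornerFTwoInertShuZhaiThirtySix ∧ WAllCornerFTwoInertKrizLiTwoFortyThree ∧
        WAllCornerFTwoInertShuZhaiOneFortyFour ∧ WAllCornerFTwoInertOffShuZhaiOffKrizLiOffShuZhaiOneFortyFour := by
  rw [wAllCornerFTwoInert_iff_shuZhai_krizLi_off]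
  constructor
  · rintro ⟨hS, hK, hO⟩
    refine ⟨hS, hK, fun W _ _ hcm hr1 hin h3 ↦ ?_, fun W _ _ hcm hr1 hin h1 h2 _ ↦ hO W hcm hr1 hin h1 h2⟩
    by_cases h1 : P2.IsIsogenousToShuZhaiThirtySixTwist W
    · exact hS W hcm hr1 hin h1
    · by_cases h2 : P2.IsIsogenousToKrizLiTwoFortyThreeTwist W
      · exact hK W hcm hr1 hin h2
      · exact hO W hcm hr1 hin h1 h2
  · rintro ⟨hS, hK, h144, hO⟩
    refine ⟨hS, hK, fun W _ _ hcm hr1 hin h1 h2 ↦ ?_⟩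
    by_cases h3 : P2.IsIsogenousToShuZhaiOneFortyFourTwist W
    · exact h144 W hcm hr1 hin h3
    · exact hO W hcm hr1 hin h1 h2 h3

/-- **The v2 residual splits**: `WAllCornerFTwoInertOffShuZhaiOffKrizLi` implies the new residual … [folklore] -/
theorem wAllCornerFTwoInertOffShuZhaiOffKrizLiOffShuZhaiOneFortyFour_of_offShuZhaiOffKrizLi
    (h : WAllCornerFTwoInertOffShuZhaiOffKrizLi) :
    WAllCornerFTwoInertOffShuZhaiOffKrizLiOffShuZhaiOneFortyFour :=
  fun W _ _ hcm hr1 hin h1 h2 _ ↦ h W hcm hr1 hin h1 h2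

/-- … and the new ON-leaf with the new residual give back the v2 residual (so the cut of the v2 residual is
EXACT: `OffShuZhaiOffKrizLi ⟺ (SZ144 on it) ∧ Off³`). [folklore] -/
theorem wAllCornerFTwoInertOffShuZhaiOffKrizLi_of_shuZhai144_of_off (h144 : WAllCornerFTwoInertShuZhaiOneFortyFour)
    (hO : WAllCornerFTwoInertOffShuZhaiOffKrizLiOffShuZhaiOneFortyFour) : WAllCornerFTwoInertOffShuZhaiOffKrizLi := by
  intro W _ _ hcm hr1 hin h1 h2
  by_cases h3 : P2.IsIsogenousToShuZhaiOneFortyFourTwist W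
  · exact h144 W hcm hr1 hin h3
  · exact hO W hcm hr1 hin h1 h2 h3

/-- The ON-leaf is implied by the row-12₂ leaf (it is a slice of it). [folklore] -/
theorem wAllCornerFTwoInertShuZhaiOneFortyFour_of_wAllCornerFTwo (h : WAllCornerFTwo) :
    WAllCornerFTwoInertShuZhaiOneFortyFour :=
  fun W _ _ hcm hr1 _ _ ↦ h W hcm hr1

/-- **The ON-leaf is a slice of `WAllCornerFTwoInertBad` ALONE** (placement §2: every member is bad at `2`;
the hypotheses `HasCM`, `CMInert` of the slice are re-derived, not used). [folklore] -/
theorem wAllCornerFTwoInertShuZhaiOneFortyFour_of_inertBad (h : WAllCornerFTwoInertBad) :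
    WAllCornerFTwoInertShuZhaiOneFortyFour := by
  intro W _ _ hcm hr1 hin hW
  exact h W hcm hr1 hin (P2.placement_of_isIsogenousToShuZhaiOneFortyFourTwist W hW).2.2

/-- The OFF-leaf (the residual) is implied by the row-12₂ leaf. [folklore] -/
theorem wAllCornerFTwoInertOffShuZhaiOffKrizLiOffShuZhaiOneFortyFour_of_wAllCornerFTwo (h : WAllCornerFTwo) :
    WAllCornerFTwoInertOffShuZhaiOffKrizLiOffShuZhaiOneFortyFour :=
  fun W _ _ hcm hr1 _ _ _ _ ↦ h W hcm hr1

/-- **Row 12₂ ⟺ split-good ∧ split-bad ∧ ramified ∧ (inert ON SZ36) ∧ (inert ON KL243) ∧ (inert ON SZ144) ∧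
(inert OFF all three)** — p4's five-way cut with the two inert slices replaced by the present four-way cut
(EXACT). [folklore] -/
theorem wAllCornerFTwo_iff_slices_shuZhai_krizLi_shuZhai144 :
    WAllCornerFTwo ↔ WAllCornerFTwoSplitGood ∧ WAllCornerFTwoSplitBad ∧ WAllCornerFTwoRamified ∧
      WAllCornerFTwoInertShuZhaiThirtySix ∧ WAllCornerFTwoInertKrizLiTwoFortyThree ∧
        WAllCornerFTwoInertShuZhaiOneFortyFour ∧ WAllCornerFTwoInertOffShuZhaiOffKrizLiOffShuZhaiOneFortyFour := by
  rw [wAllCornerFTwo_iff_slices]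
  constructor
  · rintro ⟨hSG, hSB, hR, hIG, hIB⟩
    exact ⟨hSG, hSB, hR, wAllCornerFTwoInert_iff_shuZhai_krizLi_shuZhai144_off.1 ⟨hIG, hIB⟩⟩
  · rintro ⟨hSG, hSB, hR, h4⟩
    exact ⟨hSG, hSB, hR, wAllCornerFTwoInert_iff_shuZhai_krizLi_shuZhai144_off.2 h4⟩

/-- **The sub-lane target `P2.CMNonsplitRankOneAtTwo` ⟺ ramified ∧ (ON SZ36) ∧ (ON KL243) ∧ (ON SZ144) ∧
(OFF all three).** [folklore] -/
theorem cmNonsplitRankOneAtTwo_iff_ramified_shuZhai_krizLi_shuZhai144_off :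
    P2.CMNonsplitRankOneAtTwo ↔
      WAllCornerFTwoRamified ∧ WAllCornerFTwoInertShuZhaiThirtySix ∧ WAllCornerFTwoInertKrizLiTwoFortyThree ∧
        WAllCornerFTwoInertShuZhaiOneFortyFour ∧ WAllCornerFTwoInertOffShuZhaiOffKrizLiOffShuZhaiOneFortyFour := by
  rw [cmNonsplitRankOneAtTwo_iff_nonsplitSlices]
  constructor
  · rintro ⟨hR, hIG, hIB⟩
    exact ⟨hR, wAllCornerFTwoInert_iff_shuZhai_krizLi_shuZhai144_off.1 ⟨hIG, hIB⟩⟩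
  · rintro ⟨hR, h4⟩
    exact ⟨hR, wAllCornerFTwoInert_iff_shuZhai_krizLi_shuZhai144_off.2 h4⟩

/-- **After the three ON-leaves, the inert slices ARE the OFF³-leaf**: granted proofs of the three family
leaves (each closed granted its named facts in the respective Theorems files), the two inert slices of row 12₂
hold iff `WAllCornerFTwoInertOffShuZhaiOffKrizLiOffShuZhaiOneFortyFour` holds. [folklore] -/
theorem wAllCornerFTwoInert_iff_off3_of_leaves (hS : WAllCornerFTwoInertShuZhaiThirtySix)
    (hK : WAllCornerFTwoInertKrizLiTwoFortyThree) (h144 : WAllCornerFTwoInertShuZhaiOneFortyFour) :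
    (WAllCornerFTwoInertGood ∧ WAllCornerFTwoInertBad) ↔
      WAllCornerFTwoInertOffShuZhaiOffKrizLiOffShuZhaiOneFortyFour := by
  rw [wAllCornerFTwoInert_iff_shuZhai_krizLi_shuZhai144_off]
  exact ⟨fun h ↦ h.2.2.2, fun h ↦ ⟨hS, hK, h144, h⟩⟩

end Summit.BirchSwinnertonDyer

end
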